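import Literature.NumberTheory.GaloisRepresentations.AdequacyDegreeP
import HarnessLib

/-!
# A finite absolutely irreducible linear group of order prime to `p` is adequate (extended sense)

Topic `NumberTheory/GaloisRepresentations`; a sibling of `ExtendedAdequateSubgroup.lean` (the notion
`Subgroup.IsExtendedAdequate`, GHT 2017 §1 = Thorne, Math. Z. 285 (2017) Def. 2.20) and of
`AdequacyDegreeP.lean` (GHT 2017 Thm 1.7).  The classical remark opening GHT's introduction — "If
`G` is a finite group of order prime to `p`, then it is well known that `(G, V)` is adequate.  In
this case, condition (iii) is often referred to as Burnside's Lemma" — PROVED for the tree's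
extended notion: for `H ≤ GL_n(k)` finite, `char k = p ∤ |H|`, absolutely irreducible on `kⁿ`,
all three clauses hold: (i) `Hom(H, k) = 0` (`|H| · f = f(h^{|H|}) = 0` and `|H|` is a unit of
`k`); (ii) `H¹(H, ad/Z) = 0` (restriction to the trivial subgroup, of index `|H|` invertible in
`k`, reflects coboundaries — the tree's coset averaging `MonomialAdequacy.exists_eq_sub_of_subgroup`);
(iii) every element of `H` has order prime to `p`, and the matrices of `H` span `M_n(k)` by
Burnside (tree `span_eq_top_iff_forall_isIrreducible`).

* `Subgroup.isExtendedAdequate_of_not_dvd_card` — the statement for a subgroup `H ≤ GL_n(k)`;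
* `isExtendedAdequate_range_of_not_dvd_card` — for the image of `σ : G →* GL_n(k)`, `p ∤ |G|`.

## References

* [GuralnickHerzigTiep2017] R. Guralnick, F. Herzig, P. H. Tiep, *Adequate subgroups and
  indecomposable modules*, JEMS 19 (2017) = arXiv:1405.0043, §1 (arXiv p. 1, the remark after the
  definition; definition of the extended notion p. 1–2).
* [Thorne2017TwoAdic] J. Thorne, Math. Z. 285 (2017), Def. 2.20.
-/

noncomputable section

namespace Literature.NumberTheory.GaloisRepresentations

open scoped MatrixGroups Matrix

universe u v

variable {k : Type u} [Field k] {p : ℕ} [Fact p.Prime] [CharP k p] {n : ℕ}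

/-- An absolutely irreducible `σ : G → GL_n(k)` has `n ≠ 0` (the zero representation is not
irreducible). [folklore] -/
theorem IsAbsIrreducible.pos {G : Type v} [Group G] {σ : G →* GL (Fin n) k}
    (hirr : IsAbsIrreducible σ) : 0 < n := by
  rcases Nat.eq_zero_or_pos n with rfl | hn
  · exfalso
    have h := hirr k (RingHom.id k)
    haveI : Subsingleton (Fin 0 → k) := inferInstance
    haveI : Subsingleton
        (Subrepresentation (glRepresentation ((Matrix.GeneralLinearGroup.map (RingHom.id k)).comp σ))) :=
      Subrepresentation.toSubmodule_injective.subsingleton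
    exact not_nontrivial _ h.toNontrivial
  · exact hn

omit [Fact p.Prime] [CharP k p] in
/-- Absolute irreducibility only depends on the image: `σ` absolutely irreducible ⇒ so is the
inclusion of `σ(G)`. [folklore] -/
theorem IsAbsIrreducible.range_subtype {G : Type v} [Group G] {σ : G →* GL (Fin n) k}
    (hirr : IsAbsIrreducible σ) : IsAbsIrreducible σ.range.subtype := by
  have hn := hirr.pos
  have hspan :=
    (Literature.RepresentationTheory.Semisimple.span_eq_top_iff_forall_isIrreducible hn σ).2 hirr
  have hset : (Set.range fun h : σ.range =>
      ((σ.range.subtype h : GL (Fin n) k) : Matrix (Fin n) (Fin n) k)) =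
      Set.range fun g => ((σ g : GL (Fin n) k) : Matrix (Fin n) (Fin n) k) := by
    ext M
    simp only [Set.mem_range, Subgroup.coe_subtype]
    constructor
    · rintro ⟨⟨_, g, rfl⟩, rfl⟩
      exact ⟨g, rfl⟩
    · rintro ⟨g, rfl⟩
      exact ⟨⟨σ g, g, rfl⟩, rfl⟩
  refine (Literature.RepresentationTheory.Semisimple.span_eq_top_iff_forall_isIrreducible hn
    σ.range.subtype).1 ?_
  rw [hset]
  exact hspan

/-- **A finite absolutely irreducible `H ≤ GL_n(k)` of order prime to `p = char k` is adequate in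
the extended sense** ("well known", GHT §1): (i) `Hom(H, k) = 0` as `|H|` kills `Hom` and is a unit
of `k`; (ii) `H¹(H, ad/Z) = 0` by averaging over `H` (restriction to the trivial subgroup, whose
index `|H|` is invertible in `k`, reflects coboundaries); (iii) every element is semisimple (order
prime to `p`) and the matrices of `H` span `M_n(k)` (Burnside).
[cite: GuralnickHerzigTiep2017, §1 (arXiv p. 1: "if `G` is a finite group of order prime to `p` … `(G,V)` is adequate")] -/
theorem Subgroup.isExtendedAdequate_of_not_dvd_card (H : Subgroup (GL (Fin n) k)) [Finite H]
    (hcard : ¬ p ∣ Nat.card H) (hirr : IsAbsIrreducible H.subtype) :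
    Subgroup.IsExtendedAdequate H := by
  classical
  have hcast : ((Nat.card H : ℕ) : k) ≠ 0 := fun h =>
    hcard ((CharP.cast_eq_zero_iff k p _).1 h)
  refine ⟨fun f => ?_, ?_, ?_⟩
  · -- (i) `Hom(H, k) = 0`
    ext x
    have h1 : (Nat.card H : k) * f (Additive.ofMul x) = 0 := by
      rw [← nsmul_eq_mul, ← map_nsmul, ← ofMul_pow, pow_card_eq_one', ofMul_one, map_zero]
    simpa [hcast] using h1
  · -- (ii) `H¹(H, ad/Z) = 0`: average over `H`
    rw [cocycles₁_le_coboundaries₁_iff_forall]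
    intro f hf
    change ∀ g h : H, f (g * h) = Subgroup.adModScalarRep H g (f h) + f g at hf
    change ∃ m, ∀ g : H, f g = Subgroup.adModScalarRep H g m - m
    refine MonomialAdequacy.exists_eq_sub_of_subgroup _ ⊥ (by rwa [Subgroup.index_bot]) f hf
      ⟨0, fun x hx => ?_⟩
    rw [Subgroup.mem_bot] at hx
    subst hx
    rw [map_one, Module.End.one_apply, sub_zero]
    exact MonomialAdequacy.cocycle_apply_one _ f hf
  · -- (iii) all elements are semisimple; Burnside
    have hn := hirr.pos
    have hspan :=
      (Literature.RepresentationTheory.Semisimple.span_eq_top_iff_forall_isIrreducible hn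
        H.subtype).2 hirr
    rw [eq_top_iff, ← hspan, Submodule.span_le]
    rintro _ ⟨h, rfl⟩
    refine Subgroup.mem_semisimpleSpan_of_coprime H h ?_
    rw [ringChar.eq k p, Nat.coprime_comm, Nat.Prime.coprime_iff_not_dvd Fact.out]
    intro hdvd
    exact hcard (hdvd.trans (Subgroup.orderOf_coe h ▸ orderOf_dvd_natCard h))

/-- **The image of a finite group of order prime to `p` under an absolutely irreducible
`σ : G → GL_n(k)`, `char k = p`, is adequate in the extended sense.**
[cite: GuralnickHerzigTiep2017, §1 (arXiv p. 1)] -/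
theorem isExtendedAdequate_range_of_not_dvd_card {G : Type v} [Group G] [Finite G]
    (σ : G →* GL (Fin n) k) (hcard : ¬ p ∣ Nat.card G) (hirr : IsAbsIrreducible σ) :
    Subgroup.IsExtendedAdequate σ.range := by
  haveI : Finite σ.range := Finite.of_surjective _ σ.rangeRestrict_surjective
  refine Subgroup.isExtendedAdequate_of_not_dvd_card σ.range (fun h => hcard ?_) hirr.range_subtype
  exact h.trans (Subgroup.card_dvd_of_surjective σ.rangeRestrict σ.rangeRestrict_surjective)

end Literature.NumberTheory.GaloisRepresentations

end
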